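import Summits.NavierStokesRegularity.FunctionalMining.StretchingLaminateWindows
import Summits.NavierStokesRegularity.FunctionalMining.StretchingLaminateDirection
import HarnessLib

/-!
# K1-Q1 laminate step, part 3: the laminate PROFILES `b, e₊, e₋, φ, Φ` and the torus envelopes

Cell `pub-nsfunc` (host summit NavierStokesRegularity, topic `FunctionalMining`), prove seat gen 6, for the
`LaminateStep` node (dict BLUEPRINT §1(b)(c)). **Search for candidate a priori estimates; no regularity
claim.** One-dimensional bookkeeping only.

For a weight `λ ∈ (0,1)` and a ramp width `ε` with `4ε ≤ min(λ, 1−λ)` (`LamParam`):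
* `bProf` — window, `= 1` on `[2ε, λ]`, `= 0` on `[0, ε] ∪ [λ + ε, 1]` (mod 1); its mean `mu ∈ [λ − 2ε, λ]`;
  `phi = bProf − mu` (mean zero, values in `[−mu, 1 − mu]`), `Phi` its periodic primitive (`Phi' = phi`);
* `ePlus` — window supported in `(2ε, λ) ⊂ {bProf = 1}`, `eMinus` — window supported in
  `(λ + ε, 1 − ε) ⊂ {bProf = 0}`; `∫₀¹ e₊^p ∈ [λ − 4ε, λ − 2ε]`, `∫₀¹ e₋^p ∈ [1 − λ − 4ε, 1 − λ − 2ε]`;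
* `abs_integral_comp_bProf_sub_le`: `|∫₀¹ Q(b) − (λQ(1) + (1−λ)Q(0))| ≤ 4ε·sup_{[0,1]}|Q|`;
* the torus envelopes `x ↦ e±(k·x)`, `b(k·x)` inherit the pointwise nesting (`envP_ne_zero`, `envM_ne_zero`).
-/

noncomputable section

open MeasureTheory Set Filter Topology Function intervalIntegral
open scoped ContDiff

namespace Summit.NavierStokesRegularity.FunctionalMining

open Literature.Analysis Literature.Analysis.FunctionSpaces Literature.Analysis.FunctionSpaces.Torus
open LaminateWindow LaminateDirection

/-- Laminate parameters: the weight `λ ∈ (0,1)` of the `+` phase and a ramp width `ε > 0` with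
`4ε ≤ λ`, `4ε ≤ 1 − λ`. [ours; bookkeeping] -/
structure LamParam where
  /-- weight of the `+` phase -/
  lam : ℝ
  /-- ramp width -/
  eps : ℝ
  /-- positive ramp width -/
  heps : 0 < eps
  /-- room in the `+` phase -/
  h4p : 4 * eps ≤ lam
  /-- room in the `−` phase -/
  h4m : 4 * eps ≤ 1 - lam

namespace LamParam

variable (q : LamParam)

/-- `0 < λ`. [ours; bookkeeping] -/
theorem lam_pos : 0 < q.lam := by linarith [q.heps, q.h4p]

/-- `λ < 1`. [ours; bookkeeping] -/
theorem lam_lt_one : q.lam < 1 := by linarith [q.heps, q.h4m]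

/-! ## 1. The three windows -/

/-- Window data of `b`: support `(ε, λ + ε)`, plateau `[2ε, λ]`. [ours; bookkeeping] -/
def wB : WinData := ⟨q.eps, q.lam, q.eps, q.heps, by linarith [q.heps, q.h4p], by linarith [q.heps, q.h4m], q.heps⟩

/-- Window data of `e₊`: support `(2ε, λ)`, plateau `[3ε, λ − ε]`. [ours; bookkeeping] -/
def wP : WinData := ⟨2 * q.eps, q.lam - q.eps, q.eps, by linarith [q.heps], by linarith [q.heps, q.h4p],
  by linarith [q.heps, q.h4m], q.heps⟩

/-- Window data of `e₋`: support `(λ + ε, 1 − ε)`, plateau `[λ + 2ε, 1 − 2ε]`. [ours; bookkeeping] -/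
def wM : WinData := ⟨q.lam + q.eps, 1 - 2 * q.eps, q.eps, by linarith [q.heps, q.lam_pos], by linarith [q.heps, q.h4m],
  by linarith [q.heps], q.heps⟩

/-- The laminate indicator profile `b`. [ours] -/
def bProf : ShearProfile := q.wB.window

/-- The `+` envelope profile `e₊`. [ours] -/
def ePlus : ShearProfile := q.wP.window

/-- The `−` envelope profile `e₋`. [ours] -/
def eMinus : ShearProfile := q.wM.window

/-- `b ∈ [0,1]`. [ours; bookkeeping] -/
theorem bProf_mem (t : ℝ) : q.bProf t ∈ Icc (0 : ℝ) 1 := q.wB.window_mem t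

/-- `e₊ ∈ [0,1]`. [ours; bookkeeping] -/
theorem ePlus_mem (t : ℝ) : q.ePlus t ∈ Icc (0 : ℝ) 1 := q.wP.window_mem t

/-- `e₋ ∈ [0,1]`. [ours; bookkeeping] -/
theorem eMinus_mem (t : ℝ) : q.eMinus t ∈ Icc (0 : ℝ) 1 := q.wM.window_mem t

/-- **Nesting `supp e₊ ⊂ {b = 1} ∩ {e₋ = 0}`.** [ours] -/
theorem ePlus_ne_zero {t : ℝ} (h : q.ePlus t ≠ 0) : q.bProf t = 1 ∧ q.eMinus t = 0 := by
  have hm := q.wP.fract_mem_of_window_ne_zero h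
  simp only [wP] at hm
  refine ⟨q.wB.window_eq_one (by simp only [wB]; linarith [hm.1]) (by simp only [wB]; linarith [hm.2]),
    q.wM.window_eq_zero_of_le (by simp only [wM]; linarith [hm.2, q.heps])⟩

/-- **Nesting `supp e₋ ⊂ {b = 0} ∩ {e₊ = 0}`.** [ours] -/
theorem eMinus_ne_zero {t : ℝ} (h : q.eMinus t ≠ 0) : q.bProf t = 0 ∧ q.ePlus t = 0 := by
  have hm := q.wM.fract_mem_of_window_ne_zero h
  simp only [wM] at hm
  refine ⟨q.wB.window_eq_zero_of_ge (by simp only [wB]; linarith [hm.1]),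
    q.wP.window_eq_zero_of_ge (by simp only [wP]; linarith [hm.1, q.heps])⟩

/-- `e₊ · e₋ = 0`. [ours] -/
theorem ePlus_mul_eMinus (t : ℝ) : q.ePlus t * q.eMinus t = 0 := by
  by_cases h : q.ePlus t = 0
  · rw [h, zero_mul]
  · rw [(q.ePlus_ne_zero h).2, mul_zero]

/-! ## 2. Period integrals -/

/-- The mean `μ = ∫₀¹ b`. [ours; bookkeeping] -/
def mu : ℝ := ∫ t in (0 : ℝ)..1, q.bProf t

/-- **`λ − 2ε ≤ μ ≤ λ`.** [ours] -/
theorem mu_bounds : q.lam - 2 * q.eps ≤ q.mu ∧ q.mu ≤ q.lam := by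
  have h := integral_sandwich q.bProf.continuous (c₀ := q.eps) (c₁ := 2 * q.eps) (d₁ := q.lam) (d₀ := q.lam + q.eps)
    q.heps.le (by linarith [q.heps]) (by linarith [q.heps, q.h4p]) (by linarith [q.heps]) (by linarith [q.heps, q.h4m])
    (fun t _ => q.bProf_mem t) (fun t ht => q.wB.window_eq_one_of_mem (by simpa [wB, two_mul] using ht))
    (fun t ht => q.wB.window_eq_zero_of_mem_left (by simpa [wB] using ht))
    (fun t ht => q.wB.window_eq_zero_of_mem_right (by simpa [wB] using ht))
  unfold mu
  constructor <;> linarith [h.1, h.2]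

/-- `0 < μ < 1` (indeed `μ ∈ [λ − 2ε, λ]`). [ours; bookkeeping] -/
theorem mu_pos : 0 < q.mu := by linarith [q.mu_bounds.1, q.h4p, q.heps]

/-- `|μ − λ| ≤ 2ε`. [ours] -/
theorem abs_mu_sub_lam_le : |q.mu - q.lam| ≤ 2 * q.eps := by
  rw [abs_le]; constructor <;> linarith [q.mu_bounds.1, q.mu_bounds.2, q.heps]

/-- **`∫₀¹ e₊^p ∈ [λ − 4ε, λ − 2ε]`** (`p ≥ 1`). [ours] -/
theorem integral_ePlus_pow_bounds {p : ℕ} (hp : 1 ≤ p) :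
    q.lam - 4 * q.eps ≤ ∫ t in (0 : ℝ)..1, q.ePlus t ^ p ∧ ∫ t in (0 : ℝ)..1, q.ePlus t ^ p ≤ q.lam - 2 * q.eps := by
  have hp0 : p ≠ 0 := by omega
  have h := integral_sandwich (f := fun t => q.ePlus t ^ p) (q.ePlus.continuous.pow p) (c₀ := 2 * q.eps) (c₁ := 3 * q.eps) (d₁ := q.lam - q.eps)
    (d₀ := q.lam) (by linarith [q.heps]) (by linarith [q.heps]) (by linarith [q.heps, q.h4p]) (by linarith [q.heps])
    q.lam_lt_one.le
    (fun t _ => ⟨pow_nonneg (q.ePlus_mem t).1 p, pow_le_one₀ (q.ePlus_mem t).1 (q.ePlus_mem t).2⟩)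
    (fun t ht => by rw [show q.ePlus t = 1 from q.wP.window_eq_one_of_mem (by simp only [wP]; exact ⟨by linarith [ht.1], ht.2⟩), one_pow])
    (fun t ht => by rw [show q.ePlus t = 0 from q.wP.window_eq_zero_of_mem_left (by simpa [wP] using ht), zero_pow hp0])
    (fun t ht => by rw [show q.ePlus t = 0 from q.wP.window_eq_zero_of_mem_right (by simp only [wP]; exact ⟨by linarith [ht.1], ht.2⟩), zero_pow hp0])
  constructor <;> linarith [h.1, h.2]

/-- **`∫₀¹ e₋^p ∈ [1 − λ − 4ε, 1 − λ − 2ε]`** (`p ≥ 1`). [ours] -/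
theorem integral_eMinus_pow_bounds {p : ℕ} (hp : 1 ≤ p) :
    1 - q.lam - 4 * q.eps ≤ ∫ t in (0 : ℝ)..1, q.eMinus t ^ p ∧
      ∫ t in (0 : ℝ)..1, q.eMinus t ^ p ≤ 1 - q.lam - 2 * q.eps := by
  have hp0 : p ≠ 0 := by omega
  have h := integral_sandwich (f := fun t => q.eMinus t ^ p) (q.eMinus.continuous.pow p) (c₀ := q.lam + q.eps) (c₁ := q.lam + 2 * q.eps)
    (d₁ := 1 - 2 * q.eps) (d₀ := 1 - q.eps) (by linarith [q.heps, q.lam_pos]) (by linarith [q.heps])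
    (by linarith [q.heps, q.h4m]) (by linarith [q.heps]) (by linarith [q.heps])
    (fun t _ => ⟨pow_nonneg (q.eMinus_mem t).1 p, pow_le_one₀ (q.eMinus_mem t).1 (q.eMinus_mem t).2⟩)
    (fun t ht => by rw [show q.eMinus t = 1 from q.wM.window_eq_one_of_mem (by simp only [wM]; exact ⟨by linarith [ht.1], ht.2⟩), one_pow])
    (fun t ht => by rw [show q.eMinus t = 0 from q.wM.window_eq_zero_of_mem_left (by simpa [wM] using ht), zero_pow hp0])
    (fun t ht => by rw [show q.eMinus t = 0 from q.wM.window_eq_zero_of_mem_right (by simp only [wM]; exact ⟨by linarith [ht.1], ht.2⟩), zero_pow hp0])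
  constructor <;> linarith [h.1, h.2]

/-- **`b` is two-valued off a set of length `2ε`**: for continuous `Q` with `|Q| ≤ K` on `[0,1]`,
`|∫₀¹ Q(b(t)) dt − (λ·Q 1 + (1−λ)·Q 0)| ≤ 4εK`. [ours] -/
theorem abs_integral_comp_bProf_sub_le {Q : ℝ → ℝ} (hQ : Continuous Q) {K : ℝ} (hK : ∀ s ∈ Icc (0 : ℝ) 1, |Q s| ≤ K) :
    |(∫ t in (0 : ℝ)..1, Q (q.bProf t)) - (q.lam * Q 1 + (1 - q.lam) * Q 0)| ≤ 4 * q.eps * K := by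
  have h := abs_integral_comp_sub_le q.bProf.continuous hQ hK (c₀ := q.eps) (c₁ := 2 * q.eps) (d₁ := q.lam)
    (d₀ := q.lam + q.eps) q.heps.le (by linarith [q.heps]) (by linarith [q.heps, q.h4p]) (by linarith [q.heps])
    (by linarith [q.heps, q.h4m]) (fun t _ => q.bProf_mem t)
    (fun t ht => q.wB.window_eq_one_of_mem (by simpa [wB, two_mul] using ht))
    (fun t ht => q.wB.window_eq_zero_of_mem_left (by simpa [wB] using ht))
    (fun t ht => q.wB.window_eq_zero_of_mem_right (by simpa [wB] using ht))
  have hK1 : |Q 1| ≤ K := hK 1 ⟨zero_le_one, le_rfl⟩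
  have e : (∫ t in (0 : ℝ)..1, Q (q.bProf t)) - (q.lam * Q 1 + (1 - q.lam) * Q 0) =
      ((∫ t in (0 : ℝ)..1, Q (q.bProf t)) - ((q.lam - 2 * q.eps) * Q 1 + (q.eps + (1 - (q.lam + q.eps))) * Q 0)) -
        2 * q.eps * Q 1 := by ring
  rw [e]
  calc _ ≤ |(∫ t in (0 : ℝ)..1, Q (q.bProf t)) - ((q.lam - 2 * q.eps) * Q 1 + (q.eps + (1 - (q.lam + q.eps))) * Q 0)| +
        |2 * q.eps * Q 1| := abs_sub _ _
    _ ≤ ((2 * q.eps - q.eps) + (q.lam + q.eps - q.lam)) * K + 2 * q.eps * K := by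
        refine add_le_add h ?_
        rw [abs_mul, abs_of_nonneg (by linarith [q.heps])]
        exact mul_le_mul_of_nonneg_left hK1 (by linarith [q.heps])
    _ = 4 * q.eps * K := by ring

/-! ## 3. The laminate slope profile `φ = b − μ` and its periodic primitive `Φ` -/

/-- `φ = b − μ`. [ours] -/
def phi : ShearProfile := subConst q.bProf q.mu

/-- `φ(t) = b(t) − μ`. [ours; bookkeeping] -/
@[simp] theorem phi_apply (t : ℝ) : q.phi t = q.bProf t - q.mu := rfl

/-- **`∫₀¹ φ = 0`.** [ours] -/
theorem integral_phi : ∫ t in (0 : ℝ)..1, q.phi t = 0 := by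
  simp only [phi_apply]
  rw [intervalIntegral.integral_sub (q.bProf.continuous.intervalIntegrable 0 1) intervalIntegrable_const,
    intervalIntegral.integral_const, smul_eq_mul, sub_zero, one_mul]
  unfold mu; ring

/-- `φ ∈ [−μ, 1 − μ]`. [ours] -/
theorem phi_mem (t : ℝ) : q.phi t ∈ Icc (-q.mu) (1 - q.mu) := by
  have h := q.bProf_mem t
  rw [phi_apply]; constructor <;> linarith [h.1, h.2]

/-- `|φ| ≤ 1`. [ours; bookkeeping] -/
theorem abs_phi_le (t : ℝ) : |q.phi t| ≤ 1 := by
  have h := q.phi_mem t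
  have hμ := q.mu_bounds
  rw [abs_le]; constructor <;> linarith [h.1, h.2, q.mu_pos, q.lam_lt_one]

/-- **The periodic primitive `Φ` of `φ`** (`Φ' = φ`). [ours] -/
def Phi : ShearProfile := primitive q.phi q.integral_phi

/-- `Φ'.onCircle = φ.onCircle`. [ours; bookkeeping] -/
theorem Phi_D_onCircle (y : UnitAddCircle) : q.Phi.D.onCircle y = q.phi.onCircle y :=
  primitive_D_onCircle q.phi q.integral_phi y

/-! ## 4. The torus envelopes `E±(x) = e±(k·x)`, `B(x) = b(k·x)` -/

section Torus

variable (k : Fin 3 → ℤ)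

/-- `E₊(x) = e₊(k·x)`. [ours; bookkeeping] -/
def envP (x : UnitAddTorus (Fin 3)) : ℝ := dirFun k q.ePlus x

/-- `E₋(x) = e₋(k·x)`. [ours; bookkeeping] -/
def envM (x : UnitAddTorus (Fin 3)) : ℝ := dirFun k q.eMinus x

/-- `E₊` is smooth. [folklore] -/
theorem isSmooth_envP : IsSmooth (q.envP k) := isSmooth_dirFun k q.ePlus

/-- `E₋` is smooth. [folklore] -/
theorem isSmooth_envM : IsSmooth (q.envM k) := isSmooth_dirFun k q.eMinus

/-- `0 ≤ E₊ ≤ 1`. [ours; bookkeeping] -/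
theorem envP_mem (x : UnitAddTorus (Fin 3)) : 0 ≤ q.envP k x ∧ q.envP k x ≤ 1 := dirFun_mem k q.ePlus_mem x

/-- `0 ≤ E₋ ≤ 1`. [ours; bookkeeping] -/
theorem envM_mem (x : UnitAddTorus (Fin 3)) : 0 ≤ q.envM k x ∧ q.envM k x ≤ 1 := dirFun_mem k q.eMinus_mem x

/-- **On `supp E₊` the laminate slope is at its top value and `E₋ = 0`.** [ours] -/
theorem envP_ne_zero {x : UnitAddTorus (Fin 3)} (h : q.envP k x ≠ 0) :
    dirFun k q.phi x = 1 - q.mu ∧ q.envM k x = 0 := by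
  obtain ⟨t, ht⟩ := exists_dirFun_eq k x
  unfold envP envM at *
  rw [ht] at h ⊢; rw [ht]
  have h' := q.ePlus_ne_zero h
  exact ⟨by rw [phi_apply, h'.1], h'.2⟩

/-- **On `supp E₋` the laminate slope is at its bottom value and `E₊ = 0`.** [ours] -/
theorem envM_ne_zero {x : UnitAddTorus (Fin 3)} (h : q.envM k x ≠ 0) :
    dirFun k q.phi x = -q.mu ∧ q.envP k x = 0 := by
  obtain ⟨t, ht⟩ := exists_dirFun_eq k x
  unfold envP envM at *
  rw [ht] at h ⊢; rw [ht]
  have h' := q.eMinus_ne_zero h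
  exact ⟨by rw [phi_apply, h'.1, zero_sub], h'.2⟩

/-- The laminate slope `φ(k·x) ∈ [−μ, 1 − μ]` everywhere. [ours; bookkeeping] -/
theorem dirFun_phi_mem (x : UnitAddTorus (Fin 3)) : dirFun k q.phi x ∈ Icc (-q.mu) (1 - q.mu) := by
  obtain ⟨t, ht⟩ := exists_dirFun_eq k x
  rw [ht]; exact q.phi_mem t

end Torus

end LamParam

end Summit.NavierStokesRegularity.FunctionalMining

end
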